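import Summits.AtomisticToContinuum.HydrodynamicLimit.Theorems.InformationPercolationEngineKickFairRelEquilibriumMesoTransferKey
import HarnessLib

/-!
# `KickFairRelEquilibriumMeso`, line `Sketch` — the rev 10 reshape is LOSSLESS: R-i″ ∧ R-ii″ ⇒ RU
# (crux stmt-AtomisticToContinuum-15177; `--supports`; continuation lead c4, 2026-08-16)

Companion of `…MesoDeviationCut.lean` (p127353: the uncentred deviation stub RU `stub_restartDeviationCut` of the skeleton
`Cruxes/KickFairRelEquilibriumMeso/Lines/Sketch.lean` rev 10 implies the rev 7–9 stubs R-i″ `stub_restartBiasCut` and R-ii″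
`stub_restartConcentrationCut`). Here the CONVERSE: R-i″ and R-ii″ together imply RU, verbatim — given `L, A`, R-i″ at bias target
`δ = 1/(2L)` gives `|m_B| ≤ t_N/(2L)` for the conditional mean `m_B = E_G[Z; B]/G(B)`, R-ii″ at relative deviation `1/(2L)` bounds
`G(B ∩ {|Z − m_B| > t_N/(2L)})`, and `{|Z| > t_N/L} ⊆ {|Z − m_B| > t_N/(2L)}`. So RU ⇔ R-i″ ∧ R-ii″ up to constants: merging the two
restart stubs of rev 9 into RU neither weakens nor strengthens the line. Pure bookkeeping (no measure theory beyond monotonicity);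
all hypotheses are explicit binders.
-/

noncomputable section

open MeasureTheory Set Filter Topology
open scoped ENNReal Classical

namespace Summit.AtomisticToContinuum.HydrodynamicLimit.Theorems.KickFairRelEquilibriumMesoLine

open Literature.Analysis.FluidPDE Literature.MathematicalPhysics.KineticTheory

/-- **R-i″ ∧ R-ii″ ⇒ RU (registered sub-goal `deviationCut_of_biasCut_of_concentrationCut`; the rev 10 reshape is lossless).**
See the module docstring. [folklore] -/
theorem deviationCut_of_biasCut_of_concentrationCut :
    (∀ (a₀ θ₀ : T3 → ℝ) (u₀ : T3 → V3), Continuous a₀ → Continuous θ₀ → Continuous u₀ →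
      (∀ x, 0 < a₀ x) → (∀ x, 0 < θ₀ x) →
      ∃ σ₀ : ℝ, 0 < σ₀ ∧ ∀ σ : ℝ, 0 < σ → σ < σ₀ → ∀ Φ : (N : ℕ) → Flow σ N, ∀ τ : ℝ, 0 < τ →
      ∀ g : V3 × V3 × V3 → ℝ, Continuous g → (∃ C : ℝ, ∀ p, |g p| ≤ C) →
      ∀ δ : ℝ, 0 < δ → ∀ A : ℝ, 0 < A →
      ∃ η : ℝ, 0 < η ∧ ∃ N₀ : ℕ, ∀ N : ℕ, N₀ ≤ N →
      ∀ h : Fin (N + 1) → ℕ → Past N → ℝ, (∀ i n, Measurable (h i n)) → (∀ i n p, |h i n p| ≤ 1) →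
      (∀ i n p, p.2.2.2 - p.2.1 < tN N / A → h i n p = 0) →
      ∀ t₁ t₂ : ℝ, 0 ≤ t₁ → t₁ ≤ t₂ → t₂ ≤ τ → t₂ ≤ t₁ + tN N →
      ∀ z₀ : Phase N,
      ENNReal.ofReal (Real.exp (-(η * ((N : ℝ) + 1)))) ≤
          localGibbsLaw σ a₀ u₀ θ₀ N (Φ N) {z | cellKey (rs N) (rs N) z = cellKey (rs N) (rs N) z₀} →
        |∫ z in {z | cellKey (rs N) (rs N) z = cellKey (rs N) (rs N) z₀}, slotSum (Φ N) τ (rs N) t₁ t₂ g h z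
            ∂(localGibbsLaw σ (fun _ => 1) (fun _ => 0) (fun _ => 1) N (Φ N))| ≤
          δ * tN N * (localGibbsLaw σ (fun _ => 1) (fun _ => 0) (fun _ => 1) N (Φ N)
            {z | cellKey (rs N) (rs N) z = cellKey (rs N) (rs N) z₀}).toReal) →
    (∀ (a₀ θ₀ : T3 → ℝ) (u₀ : T3 → V3), Continuous a₀ → Continuous θ₀ → Continuous u₀ →
      (∀ x, 0 < a₀ x) → (∀ x, 0 < θ₀ x) →
      ∃ σ₀ : ℝ, 0 < σ₀ ∧ ∀ σ : ℝ, 0 < σ → σ < σ₀ → ∀ Φ : (N : ℕ) → Flow σ N, ∀ τ : ℝ, 0 < τ →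
      ∀ g : V3 × V3 × V3 → ℝ, Continuous g → (∃ C : ℝ, ∀ p, |g p| ≤ C) →
      ∀ L : ℝ, 0 < L → ∀ A : ℝ, 0 < A →
      ∃ c : ℝ, 0 < c ∧ ∃ η : ℝ, 0 < η ∧ ∃ N₀ : ℕ, ∀ N : ℕ, N₀ ≤ N →
      ∀ h : Fin (N + 1) → ℕ → Past N → ℝ, (∀ i n, Measurable (h i n)) → (∀ i n p, |h i n p| ≤ 1) →
      (∀ i n p, p.2.2.2 - p.2.1 < tN N / A → h i n p = 0) →
      ∀ t₁ t₂ : ℝ, 0 ≤ t₁ → t₁ ≤ t₂ → t₂ ≤ τ → t₂ ≤ t₁ + tN N →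
      ∀ z₀ : Phase N,
      ENNReal.ofReal (Real.exp (-(η * ((N : ℝ) + 1)))) ≤
          localGibbsLaw σ a₀ u₀ θ₀ N (Φ N) {z | cellKey (rs N) (rs N) z = cellKey (rs N) (rs N) z₀} →
        localGibbsLaw σ (fun _ => 1) (fun _ => 0) (fun _ => 1) N (Φ N)
            ({z | cellKey (rs N) (rs N) z = cellKey (rs N) (rs N) z₀} ∩
              {z | tN N / L < |slotSum (Φ N) τ (rs N) t₁ t₂ g h z -
                (localGibbsLaw σ (fun _ => 1) (fun _ => 0) (fun _ => 1) N (Φ N)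
                    {z | cellKey (rs N) (rs N) z = cellKey (rs N) (rs N) z₀}).toReal⁻¹ *
                  ∫ z in {z | cellKey (rs N) (rs N) z = cellKey (rs N) (rs N) z₀}, slotSum (Φ N) τ (rs N) t₁ t₂ g h z
                    ∂(localGibbsLaw σ (fun _ => 1) (fun _ => 0) (fun _ => 1) N (Φ N))|}) ≤
          ENNReal.ofReal (Real.exp (-(c * ((N : ℝ) + 1)))) *
            localGibbsLaw σ (fun _ => 1) (fun _ => 0) (fun _ => 1) N (Φ N)
              {z | cellKey (rs N) (rs N) z = cellKey (rs N) (rs N) z₀}) →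
    ∀ (a₀ θ₀ : T3 → ℝ) (u₀ : T3 → V3), Continuous a₀ → Continuous θ₀ → Continuous u₀ →
    (∀ x, 0 < a₀ x) → (∀ x, 0 < θ₀ x) →
    ∃ σ₀ : ℝ, 0 < σ₀ ∧ ∀ σ : ℝ, 0 < σ → σ < σ₀ → ∀ Φ : (N : ℕ) → Flow σ N, ∀ τ : ℝ, 0 < τ →
    ∀ g : V3 × V3 × V3 → ℝ, Continuous g → (∃ C : ℝ, ∀ p, |g p| ≤ C) →
    ∀ L : ℝ, 0 < L → ∀ A : ℝ, 0 < A →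
    ∃ c : ℝ, 0 < c ∧ ∃ η : ℝ, 0 < η ∧ ∃ N₀ : ℕ, ∀ N : ℕ, N₀ ≤ N →
    ∀ h : Fin (N + 1) → ℕ → Past N → ℝ, (∀ i n, Measurable (h i n)) → (∀ i n p, |h i n p| ≤ 1) →
    (∀ i n p, p.2.2.2 - p.2.1 < tN N / A → h i n p = 0) →
    ∀ t₁ t₂ : ℝ, 0 ≤ t₁ → t₁ ≤ t₂ → t₂ ≤ τ → t₂ ≤ t₁ + tN N →
    ∀ z₀ : Phase N,
    ENNReal.ofReal (Real.exp (-(η * ((N : ℝ) + 1)))) ≤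
        localGibbsLaw σ a₀ u₀ θ₀ N (Φ N) {z | cellKey (rs N) (rs N) z = cellKey (rs N) (rs N) z₀} →
      localGibbsLaw σ (fun _ => 1) (fun _ => 0) (fun _ => 1) N (Φ N)
          ({z | cellKey (rs N) (rs N) z = cellKey (rs N) (rs N) z₀} ∩
            {z | tN N / L < |slotSum (Φ N) τ (rs N) t₁ t₂ g h z|}) ≤
        ENNReal.ofReal (Real.exp (-(c * ((N : ℝ) + 1)))) *
          localGibbsLaw σ (fun _ => 1) (fun _ => 0) (fun _ => 1) N (Φ N)
            {z | cellKey (rs N) (rs N) z = cellKey (rs N) (rs N) z₀} := by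
  intro hB1 hC2 a₀ θ₀ u₀ ha hθ hu ha0 hθ0
  obtain ⟨σ₁, hσ₁, hB1⟩ := hB1 a₀ θ₀ u₀ ha hθ hu ha0 hθ0
  obtain ⟨σ₂, hσ₂, hC2⟩ := hC2 a₀ θ₀ u₀ ha hθ hu ha0 hθ0
  refine ⟨min σ₁ σ₂, lt_min hσ₁ hσ₂, fun σ hσ hσlt Φ τ hτ g hg hgb L hL A hA => ?_⟩
  have hσ₁' : σ < σ₁ := hσlt.trans_le (min_le_left _ _)
  have hσ₂' : σ < σ₂ := hσlt.trans_le (min_le_right _ _)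
  have h2L : (0 : ℝ) < 2 * L := by positivity
  have hδ : (0 : ℝ) < 1 / (2 * L) := by positivity
  obtain ⟨η₁, hη₁, N₁, hbias⟩ := hB1 σ hσ hσ₁' Φ τ hτ g hg hgb (1 / (2 * L)) hδ A hA
  obtain ⟨c, hc, η₂, hη₂, N₂, hconc⟩ := hC2 σ hσ hσ₂' Φ τ hτ g hg hgb (2 * L) h2L A hA
  refine ⟨c, hc, min η₁ η₂, lt_min hη₁ hη₂, max N₁ N₂,
    fun N hN h hh hhb hcut t₁ t₂ ht₁ h12 ht₂τ hlen z₀ hB => ?_⟩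
  have hN₁ : N₁ ≤ N := le_trans (le_max_left _ _) hN
  have hN₂' : N₂ ≤ N := le_trans (le_max_right _ _) hN
  have hN0 : (0 : ℝ) ≤ (N : ℝ) + 1 := by positivity
  have hfloor : ∀ η' : ℝ, min η₁ η₂ ≤ η' →
      ENNReal.ofReal (Real.exp (-(η' * ((N : ℝ) + 1)))) ≤
        localGibbsLaw σ a₀ u₀ θ₀ N (Φ N) {z | cellKey (rs N) (rs N) z = cellKey (rs N) (rs N) z₀} := by
    intro η' hη'
    refine le_trans (ENNReal.ofReal_le_ofReal (Real.exp_le_exp.2 ?_)) hB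
    nlinarith [mul_le_mul_of_nonneg_right hη' hN0]
  set ν : Measure (Phase N) := localGibbsLaw σ (fun _ => 1) (fun _ => 0) (fun _ => 1) N (Φ N) with hνdef
  set B : Set (Phase N) := {z | cellKey (rs N) (rs N) z = cellKey (rs N) (rs N) z₀} with hBdef
  set Z : Phase N → ℝ := slotSum (Φ N) τ (rs N) t₁ t₂ g h with hZdef
  -- the centre is small: |m_B| ≤ t_N/(2L)
  have hmean := hbias N hN₁ h hh hhb hcut t₁ t₂ ht₁ h12 ht₂τ hlen z₀ (hfloor η₁ (min_le_left _ _))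
  have hG0 : 0 ≤ (ν B).toReal := ENNReal.toReal_nonneg
  have htN := (tN_pos N).le
  set m : ℝ := (ν B).toReal⁻¹ * ∫ z in B, Z z ∂ν with hmdef
  have hm : |m| ≤ tN N / (2 * L) := by
    rcases eq_or_lt_of_le hG0 with h0 | hpos
    · rw [hmdef, ← h0, inv_zero, zero_mul, abs_zero]; positivity
    · rw [hmdef, abs_mul, abs_inv, abs_of_pos hpos]
      calc (ν B).toReal⁻¹ * |∫ z in B, Z z ∂ν| ≤ (ν B).toReal⁻¹ * (1 / (2 * L) * tN N * (ν B).toReal) :=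
            mul_le_mul_of_nonneg_left hmean (inv_nonneg.2 hG0)
        _ = tN N / (2 * L) := by field_simp
  -- inclusion of the deviation events
  have hsub : B ∩ {z | tN N / L < |Z z|} ⊆ B ∩ {z | tN N / (2 * L) < |Z z - m|} := by
    rintro z ⟨hzB, hz⟩
    refine ⟨hzB, ?_⟩
    simp only [mem_setOf_eq] at hz ⊢
    have h1 : |Z z| ≤ |Z z - m| + |m| := by
      have := abs_add_le (Z z - m) m
      rwa [sub_add_cancel] at this
    have h2 : tN N / L = tN N / (2 * L) + tN N / (2 * L) := by field_simp; ring
    linarith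
  have hconcN := hconc N hN₂' h hh hhb hcut t₁ t₂ ht₁ h12 ht₂τ hlen z₀ (hfloor η₂ (min_le_right _ _))
  exact (measure_mono hsub).trans hconcN

end Summit.AtomisticToContinuum.HydrodynamicLimit.Theorems.KickFairRelEquilibriumMesoLine

end
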